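import Summits.KontsevichZagierPeriods.KontsevichZagierPeriods.Theses.AbelContraction
import Summits.KontsevichZagierPeriods.KontsevichZagierPeriods.Theorems.LiouvilleUnfoldingAyoubPiLocalKernelDimensionLadder
import Summits.KontsevichZagierPeriods.KontsevichZagierPeriods.Theorems.AbelContractionRealArcKernelSolidVolumes

/-!
# KontsevichZagierPeriods / AbelContraction — crux `RealArcKernel` (stmt-KontsevichZagierPeriods-12472),
# line `dimtwo_redirect`: the volume filtration RELATIVE TO A SUBGROUP `R ≥ KZ.relations`, every dimension
# (support file, lands `--supports`; registered sub-goal `sub_mem_of_solidPairs_dim`)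

Line `dimtwo_redirect` reshaped the crux to `SolidVolumes₃ ∧ ReductionToDimensionTwo` and recorded the
tail in the solids currency (`RealArcKernelSolidVolumes`: `RedSolid₃`). The absolute graded principle is
already in the tree — `LiouvilleUnfolding.NilradicalCut.kzKernel_dim_le_iff_volumeConjecture_succ`
("Conjecture 1 for combinations of dimensions `≤ d` ⟺ the volume conjecture for compact bodies of
`ℝ^{d+1}`", both directions, Theorems/LiouvilleUnfoldingAyoubPiLocalKernelDimensionLadder.lean) with the
graded normal form `exists_isBounded_sub_mem_relations_of_mem_closure_dim_le`. What the reductions of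
THIS route need is the same ladder RELATIVE to an arbitrary subgroup `R ≥ KZ.relations` (the shape of
`ReductionToDimensionOne` / `ReductionToDimensionTwo` / `RedSolid_D`), which is what this file adds, for
every `D = d + 1`. Write (in words only; nothing is defined)

* `VolSolid D` : equal-volume BOUNDED volume representations of dimension `D` are KZ-equivalent;
* `RedSolid D` : every `R ≥ KZ.relations` containing `[u] − [v]` for all such pairs contains `ker KZ.eval`.

Proved here, sorry-free, for every `d`:
* `sub_mem_of_solidPairs_dim` (registered sub-goal) — if `R ≥ KZ.relations` contains the equal-volume
  pairs of bounded solids of dimension `d + 1`, it contains `[r] − [r′]` for every equal-valued pair of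
  representations of dimensions `≤ d`; `equivalent_of_volSolid` — the case `R = KZ.relations`;
* `mem_of_solidPairs_of_mem_closure` — **`RedSolid (d+1)` HOLDS on the part of `ker KZ.eval` generated in
  dimensions `≤ d`** (the provable core of every rung; what is open is exactly the inputs of dimension
  `> d`), from the tree's graded normal form;
* the ladder in this currency: `redSolid_mono` (`RedSolid (d+1) → RedSolid (d+2)`: tails get WEAKER
  going up), `volSolid_of_kontsevichZagierPeriods`, `redSolid_of_kontsevichZagierPeriods`,
  `kontsevichZagierPeriods_of_volSolid_of_redSolid` (for every `d` the summit is EXACTLY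
  `VolSolid (d+1) ∧ RedSolid (d+1)`, as three implications), `redSolid_of_realArcKernel_dim`
  (`RealArcKernel → RedSolid (d+1)` for `d ≥ 1`: every such tail is NECESSARY for the crux) and
  `realArcKernel_of_volSolid_of_redSolid` (jointly SUFFICIENT).

Sources: M. Kontsevich, D. Zagier, *Periods* (2001), §1.2; J. Cresson, J. Viu-Sos (2022), §1;
J. Viu-Sos (2021), Cor. 2.3. Deliberately NOT here: any attack on a `VolSolid D` (`D ≥ 3`) or `RedSolid D`.
-/

noncomputable section

open Literature.NumberTheory.Transcendental
open Summit.KontsevichZagierPeriods.LiouvilleUnfolding.NilradicalCut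
  (exists_isBounded_sub_mem_relations_of_mem_closure_dim_le)

namespace Summit.KontsevichZagierPeriods.AbelContraction.RealArcKernelVolumeFiltration

variable {d : ℕ}

/-- **`RedSolid (d+1)` holds on the part of the kernel generated in dimensions `≤ d`** (proved): if
`R ≥ KZ.relations` contains the equal-volume pairs of bounded solids of dimension `d + 1`, then it
contains every value-`0` `ℤ`-combination of representations of dimensions `≤ d` — graded normal form
`x ≡ [A] − [B]` (`exists_isBounded_sub_mem_relations_of_mem_closure_dim_le`), `vol A = vol B` by
soundness, `[A] − [B] ∈ R`. [cite: KontsevichZagier2001, §1.2 Conjecture 1] -/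
theorem mem_of_solidPairs_of_mem_closure {R : AddSubgroup KZ.FormalRep} (hR : KZ.relations ≤ R)
    (hS : ∀ (u v : KZ.IntegralRep (d + 1)), (Bornology.IsBounded u.domain ∧ ∀ z ∈ u.domain, u.integrand z = 1) →
      (Bornology.IsBounded v.domain ∧ ∀ z ∈ v.domain, v.integrand z = 1) → u.value = v.value →
      KZ.of u - KZ.of v ∈ R)
    {x : KZ.FormalRep}
    (hx : x ∈ AddSubgroup.closure {y : KZ.FormalRep | ∃ (m : ℕ) (r : KZ.IntegralRep m), m ≤ d ∧ y = KZ.of r})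
    (hx0 : KZ.eval x = 0) : x ∈ R := by
  obtain ⟨A, B, hAb, hBb, hA1, hB1, e⟩ := exists_isBounded_sub_mem_relations_of_mem_closure_dim_le hx
  have hker : KZ.eval (x - (KZ.of A - KZ.of B)) = 0 := KZ.eval_eq_zero_of_mem_relations e
  rw [map_sub, hx0, zero_sub, neg_eq_zero, KZ.eval_of_sub_of, sub_eq_zero] at hker
  have hAB : KZ.of A - KZ.of B ∈ R := hS A B ⟨hAb, hA1⟩ ⟨hBb, hB1⟩ hker
  have : x = (x - (KZ.of A - KZ.of B)) + (KZ.of A - KZ.of B) := by abel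
  rw [this]
  exact R.add_mem (hR e) hAB

/-- **Equal-volume bounded solids of dimension `d + 1` control all pairs of dimensions `≤ d`, relative
to any `R ≥ KZ.relations`** (registered sub-goal `sub_mem_of_solidPairs_dim` of stmt-12472; `d = 2` is
`RealArcKernelSolidVolumes.sub_mem_of_solidPairs`): `[r] − [r′]` is a value-`0` combination generated in
dimensions `≤ d`. [cite: KontsevichZagier2001, §1.2 Conjecture 1] -/
theorem sub_mem_of_solidPairs_dim : ∀ {d : ℕ} {R : AddSubgroup KZ.FormalRep}, KZ.relations ≤ R → (∀ (u v : KZ.IntegralRep (d + 1)), (Bornology.IsBounded u.domain ∧ ∀ z ∈ u.domain, u.integrand z = 1) → (Bornology.IsBounded v.domain ∧ ∀ z ∈ v.domain, v.integrand z = 1) → u.value = v.value → KZ.of u - KZ.of v ∈ R) → ∀ ⦃n m : ℕ⦄, n ≤ d → m ≤ d → ∀ (r : KZ.IntegralRep n) (r' : KZ.IntegralRep m), r.value = r'.value → KZ.of r - KZ.of r' ∈ R := by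
  intro d R hR hS n m hn hm r r' hv
  refine mem_of_solidPairs_of_mem_closure hR hS
    (sub_mem (AddSubgroup.subset_closure ⟨n, r, hn, rfl⟩) (AddSubgroup.subset_closure ⟨m, r', hm, rfl⟩)) ?_
  rw [KZ.eval_of_sub_of, hv, sub_self]

/-- **`VolSolid (d+1)` decides Conjecture 1 in dimensions `≤ d`** (the case `R = KZ.relations`; the
absolute statement with compact bodies and its converse by volume descent are
`NilradicalCut.kzKernel_dim_le_iff_volumeConjecture_succ`). [cite: CressonViusos2022, §1 p. 326] -/
theorem equivalent_of_volSolid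
    (hS : ∀ (u v : KZ.IntegralRep (d + 1)), (Bornology.IsBounded u.domain ∧ ∀ z ∈ u.domain, u.integrand z = 1) →
      (Bornology.IsBounded v.domain ∧ ∀ z ∈ v.domain, v.integrand z = 1) → u.value = v.value →
      KZ.Equivalent u v)
    {n m : ℕ} (hn : n ≤ d) (hm : m ≤ d) (r : KZ.IntegralRep n) (r' : KZ.IntegralRep m)
    (hv : r.value = r'.value) : KZ.Equivalent r r' :=
  sub_mem_of_solidPairs_dim le_rfl hS hn hm r r' hv

/-! ## The ladder in the `RedSolid` currency -/

/-- **The tails get weaker going up**: `RedSolid (d+1) → RedSolid (d+2)` — equal-volume solid pairs of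
dimension `d + 2` in `R` put all pairs of dimensions `≤ d + 1` in `R` (`sub_mem_of_solidPairs_dim`), in
particular the solid pairs of dimension `d + 1`. [cite: KontsevichZagier2001, §1.2 Conjecture 1] -/
theorem redSolid_mono
    (h : ∀ R : AddSubgroup KZ.FormalRep, KZ.relations ≤ R →
      (∀ (u v : KZ.IntegralRep (d + 1)), (Bornology.IsBounded u.domain ∧ ∀ z ∈ u.domain, u.integrand z = 1) →
        (Bornology.IsBounded v.domain ∧ ∀ z ∈ v.domain, v.integrand z = 1) → u.value = v.value →
        KZ.of u - KZ.of v ∈ R) →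
      ∀ x : KZ.FormalRep, KZ.eval x = 0 → x ∈ R) :
    ∀ R : AddSubgroup KZ.FormalRep, KZ.relations ≤ R →
      (∀ (u v : KZ.IntegralRep (d + 2)), (Bornology.IsBounded u.domain ∧ ∀ z ∈ u.domain, u.integrand z = 1) →
        (Bornology.IsBounded v.domain ∧ ∀ z ∈ v.domain, v.integrand z = 1) → u.value = v.value →
        KZ.of u - KZ.of v ∈ R) →
      ∀ x : KZ.FormalRep, KZ.eval x = 0 → x ∈ R :=
  fun R hR hS x hx => h R hR (fun u v _ _ huv => sub_mem_of_solidPairs_dim hR hS le_rfl le_rfl u v huv) x hx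

/-- **The summit implies every layer** `VolSolid (d+1)` (bounded solids are KZ-rational,
`RealArcKernelSolidVolumes.isRational_of_integrand_eq_one`). [cite: KontsevichZagier2001, §1.2 Conjecture 1] -/
theorem volSolid_of_kontsevichZagierPeriods (h : KontsevichZagierPeriods) :
    ∀ (u v : KZ.IntegralRep (d + 1)), (Bornology.IsBounded u.domain ∧ ∀ z ∈ u.domain, u.integrand z = 1) →
      (Bornology.IsBounded v.domain ∧ ∀ z ∈ v.domain, v.integrand z = 1) → u.value = v.value →
      KZ.Equivalent u v :=
  fun u v hu hv huv =>
    h u v (Summit.KontsevichZagierPeriods.AbelContraction.RealArcKernelSolidVolumes.isRational_of_integrand_eq_one u hu.2)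
      (Summit.KontsevichZagierPeriods.AbelContraction.RealArcKernelSolidVolumes.isRational_of_integrand_eq_one v hv.2) huv

/-- **The summit implies every tail** `RedSolid (d+1)` (its kernel form: `ker eval = relations ≤ R`).
[cite: KontsevichZagier2001, §1.2 Conjecture 1] -/
theorem redSolid_of_kontsevichZagierPeriods (h : KontsevichZagierPeriods) :
    ∀ R : AddSubgroup KZ.FormalRep, KZ.relations ≤ R →
      (∀ (u v : KZ.IntegralRep (d + 1)), (Bornology.IsBounded u.domain ∧ ∀ z ∈ u.domain, u.integrand z = 1) →
        (Bornology.IsBounded v.domain ∧ ∀ z ∈ v.domain, v.integrand z = 1) → u.value = v.value →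
        KZ.of u - KZ.of v ∈ R) →
      ∀ x : KZ.FormalRep, KZ.eval x = 0 → x ∈ R :=
  fun _ hR _ x hx => hR (kzKernelConjecture_iff_isRational.mpr h x hx)

/-- **Layer and tail of one dimension jointly give the summit**: `VolSolid (d+1) → RedSolid (d+1) →
KontsevichZagierPeriods` (at `R = KZ.relations` the layer makes the tail's hypothesis true; the tail
gives the kernel form, equivalent to the summit by `kzKernelConjecture_iff_isRational`). So for every
`d` the summit splits EXACTLY as `VolSolid (d+1) ∧ RedSolid (d+1)`. [cite: KontsevichZagier2001, §1.2 Conjecture 1] -/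
theorem kontsevichZagierPeriods_of_volSolid_of_redSolid
    (hS : ∀ (u v : KZ.IntegralRep (d + 1)), (Bornology.IsBounded u.domain ∧ ∀ z ∈ u.domain, u.integrand z = 1) →
      (Bornology.IsBounded v.domain ∧ ∀ z ∈ v.domain, v.integrand z = 1) → u.value = v.value →
      KZ.Equivalent u v)
    (hRed : ∀ R : AddSubgroup KZ.FormalRep, KZ.relations ≤ R →
      (∀ (u v : KZ.IntegralRep (d + 1)), (Bornology.IsBounded u.domain ∧ ∀ z ∈ u.domain, u.integrand z = 1) →
        (Bornology.IsBounded v.domain ∧ ∀ z ∈ v.domain, v.integrand z = 1) → u.value = v.value →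
        KZ.of u - KZ.of v ∈ R) →
      ∀ x : KZ.FormalRep, KZ.eval x = 0 → x ∈ R) : KontsevichZagierPeriods :=
  kzKernelConjecture_iff_isRational.mp fun x hx => hRed KZ.relations le_rfl hS x hx

/-- **Every tail from dimension `2` on is NECESSARY for the crux**: `RealArcKernel → RedSolid (d+1)` for
`1 ≤ d` — solid pairs of dimension `d + 1 ≥ 2` in `R` put the one-dimensional pairs in `R`
(`sub_mem_of_solidPairs_dim`), and the landed `reductionToDimensionOne_of_realArcKernel` (p143402)
puts `ker KZ.eval` in `R`. [cite: KontsevichZagier2001, §1.2 Conjecture 1] -/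
theorem redSolid_of_realArcKernel_dim (hd : 1 ≤ d)
    (h : Summit.KontsevichZagierPeriods.KontsevichZagierPeriods.Theses.AbelContraction.RealArcKernel) :
    ∀ R : AddSubgroup KZ.FormalRep, KZ.relations ≤ R →
      (∀ (u v : KZ.IntegralRep (d + 1)), (Bornology.IsBounded u.domain ∧ ∀ z ∈ u.domain, u.integrand z = 1) →
        (Bornology.IsBounded v.domain ∧ ∀ z ∈ v.domain, v.integrand z = 1) → u.value = v.value →
        KZ.of u - KZ.of v ∈ R) →
      ∀ x : KZ.FormalRep, KZ.eval x = 0 → x ∈ R :=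
  fun R hR hS x hx =>
    Summit.KontsevichZagierPeriods.AbelContraction.RealArcKernelStrength.reductionToDimensionOne_of_realArcKernel
      h R hR (fun r r' hv => sub_mem_of_solidPairs_dim hR hS hd hd r r' hv) x hx

/-- **Layer and tail of one dimension jointly give the crux** (through the summit,
`realArcKernel_of_kontsevichZagierPeriods`). [cite: KontsevichZagier2001, §1.2 Conjecture 1] -/
theorem realArcKernel_of_volSolid_of_redSolid
    (hS : ∀ (u v : KZ.IntegralRep (d + 1)), (Bornology.IsBounded u.domain ∧ ∀ z ∈ u.domain, u.integrand z = 1) →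
      (Bornology.IsBounded v.domain ∧ ∀ z ∈ v.domain, v.integrand z = 1) → u.value = v.value →
      KZ.Equivalent u v)
    (hRed : ∀ R : AddSubgroup KZ.FormalRep, KZ.relations ≤ R →
      (∀ (u v : KZ.IntegralRep (d + 1)), (Bornology.IsBounded u.domain ∧ ∀ z ∈ u.domain, u.integrand z = 1) →
        (Bornology.IsBounded v.domain ∧ ∀ z ∈ v.domain, v.integrand z = 1) → u.value = v.value →
        KZ.of u - KZ.of v ∈ R) →
      ∀ x : KZ.FormalRep, KZ.eval x = 0 → x ∈ R) :
    Summit.KontsevichZagierPeriods.KontsevichZagierPeriods.Theses.AbelContraction.RealArcKernel :=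
  Summit.KontsevichZagierPeriods.AbelContraction.RealArcKernelStrength.realArcKernel_of_kontsevichZagierPeriods
    (kontsevichZagierPeriods_of_volSolid_of_redSolid hS hRed)

end Summit.KontsevichZagierPeriods.AbelContraction.RealArcKernelVolumeFiltration

end
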